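import Summits.ValiantsHypothesis.ValiantsHypothesis.Theorems.NewtonFramesTwoProductsFrameRungTwoBlockPartition

/-!
# Crux `TwoProducts` (stmt-5906), line `FrameRungTwo`: the word form of axiom (A2) — the other frame's words of the corners of a
partition of the vertex word can never be disjoint (no hypothesis on the frames, any coefficients)

Setting of the shallow-neighbour lemma (IX) (`hIX` of `…FrameRungTwoShallowNeighbour.lean`, p603280): two dissociated frames `f`, `g`
with `lexKey`-tops `T`, `T'`, common top, a vertex word `a` of `f` (`Σ a = e`), every point key-above `e` cancelled, `e` itself not;
`J = {j : a j ≠ T j}` is the demotion set.  For `F ⊆ J` the CORNER `a^F` (the vertex word promoted to the top outside `F`) is a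
cancelled point, hence (`promote_word`, p602840) the sum of a unique word `c^F` of `g`.
`…FrameRungTwoBlockPartition.lean` (p610177) proved (A2) for BLOCKS (corners whose `g`-word demotes ONE letter): `J` has no partition
into `≥ 2` blocks of distinct colours.  Here the same is proved for ARBITRARY corner words:

* `no_disjoint_corner_words_of_vertex` — for every partition `P` of `J` into `≥ 2` nonempty parts, the `g`-words `c^F` (`F ∈ P`) of the
  corners cannot have pairwise disjoint demotion sets.  (Blocks = the special case `|{i : c^F i ≠ T' i}| = 1`.)
* `corner_words_collide` — the two-part case: for `∅ ≠ F ⊊ J` the `g`-words of the complementary corners `a^F`, `a^{J∖F}` demote a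
  common coordinate of `g`.
* `single_demotions_collide` — the finest case: the `g`-words of the `|J| ≥ 2` single-letter demotions `T[j ↦ a j]` are not pairwise
  disjoint; in particular the non-member frame of a cross-cancelling vertex of member depth `≥ 2` is never "generic" in the sense of
  `…FrameRungTwoGenericShallow.lean` (its light gap multisets do not have unique sums).

Proof: glue the words `c^F` along their disjoint demotion sets into one word `b'` of `g`; its gap sum is `Σ_F gap(a^F) = gap(a)`, so
`Σ b' = e`, and by `promote_ratio` (p602840) its coefficient ratio is the product of the block ratios `Π_{j∈F} c(a j)/c(T j)`, i.e.
`Π c'(b') = −Π c(a)` — contradicting `not_word_of_vertex`.  These are the word-level tools ((A2ʷ) and the "complementary corners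
collide" fact) on which every analysis of the general (coincidence) case of (IX) rests (memo `Cruxes/TwoProducts/memo-IX-windows.md`).
Honest scope: structural lemmas for ONE stub of a rung strictly below the crux `TwoProducts`; nothing here bears on `VP ≠ VNP`.
[ours; setting KPTT arXiv:1308.2286 §2, §5]
-/

set_option linter.dupNamespace false

namespace Summit.ValiantsHypothesis.ValiantsHypothesis.Theorems.NewtonFramesTwoProducts.FrameRungTwoTrinomial

open MvPolynomial
open scoped BigOperators Classical
open Summit.ValiantsHypothesis.Theorems.DissociatedFixedK (lexKey lexKey_injective)
open Summit.ValiantsHypothesis.ValiantsHypothesis.Theorems.DissociatedFixedK.Negative (emb emb_injective)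
open Summit.ValiantsHypothesis.ValiantsHypothesis.Theorems.NewtonFramesTwoProducts.FrameRungTwoBinomial
  (emb_add emb_sum apply_le_of_lexKey_le eq_T_of_not_mem_filter ne_T_of_mem_filter coeff_word exists_word prod_coeff_ne_zero
   topCoeff_add_eq_zero)

noncomputable section

section CornerWords

variable {m : ℕ}

/-- **(A2) for words: the `g`-words of the corners of a partition of the demotion set into `≥ 2` parts are never pairwise disjoint.**
Data: `P` a family of `≥ 2` nonempty pairwise disjoint subsets with union `J = {j : a j ≠ T j}`; for `F ∈ P` a word `c F` of `g` whose sum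
is the corner `Σ_j (if j ∈ F then a j else T j)`; hypothesis: the demotion sets `{i : c F i ≠ T' i}` are pairwise disjoint.  Conclusion:
`False`. [ours] -/
theorem no_disjoint_corner_words_of_vertex (l : (Fin 2 → ℝ) →L[ℝ] ℝ) (f g : Fin m → MvPolynomial (Fin 2) ℂ)
    (T T' : Fin m → (Fin 2 →₀ ℕ))
    (hT : ∀ j, T j ∈ (f j).support) (hTmax : ∀ j, ∀ x ∈ (f j).support, lexKey l x ≤ lexKey l (T j))
    (hT' : ∀ j, T' j ∈ (g j).support)
    (hinjf : ∀ a b : Fin m → (Fin 2 →₀ ℕ), (∀ j, a j ∈ (f j).support) → (∀ j, b j ∈ (f j).support) →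
      ∑ j, a j = ∑ j, b j → a = b)
    (hinjg : ∀ a b : Fin m → (Fin 2 →₀ ℕ), (∀ j, a j ∈ (g j).support) → (∀ j, b j ∈ (g j).support) →
      ∑ j, a j = ∑ j, b j → a = b)
    (e : Fin 2 →₀ ℕ)
    (hzero : ∀ x : Fin 2 →₀ ℕ, x ≠ e → l (emb e) ≤ l (emb x) → coeff x (∏ j, f j) + coeff x (∏ j, g j) = 0)
    (he : coeff e (∏ j, f j) + coeff e (∏ j, g j) ≠ 0)
    (htop : ∑ j, T j = ∑ j, T' j) (hTe : lexKey l e < lexKey l (∑ j, T j))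
    {a : Fin m → (Fin 2 →₀ ℕ)} (ha : ∀ j, a j ∈ (f j).support) (hea : ∑ j, a j = e)
    (P : Finset (Finset (Fin m)))
    (hPne : ∀ F ∈ P, F.Nonempty) (hPdisj : ∀ F ∈ P, ∀ F' ∈ P, F ≠ F' → Disjoint F F')
    (hPU : P.biUnion id = Finset.univ.filter fun i => a i ≠ T i) (hP2 : 2 ≤ P.card)
    (c : Finset (Fin m) → Fin m → (Fin 2 →₀ ℕ)) (hc : ∀ F ∈ P, ∀ i, c F i ∈ (g i).support)
    (hcsum : ∀ F ∈ P, ∑ i, c F i = ∑ j, (fun j => if j ∈ F then a j else T j) j)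
    (hcdisj : ∀ F ∈ P, ∀ F' ∈ P, F ≠ F' →
      Disjoint (Finset.univ.filter fun i => c F i ≠ T' i) (Finset.univ.filter fun i => c F' i ≠ T' i)) : False := by
  have hFJ : ∀ F ∈ P, F ⊆ Finset.univ.filter (fun i => a i ≠ T i) := fun F hF => by
    rw [← hPU]; exact Finset.subset_biUnion_of_mem id hF
  -- Step 1: ratio identity for every part, via `promote_word` / uniqueness / `promote_ratio`.
  have hblock : ∀ F ∈ P,
      ∏ j ∈ F, (coeff (a j) (f j) / coeff (T j) (f j)) =
        ∏ i ∈ Finset.univ.filter (fun i => c F i ≠ T' i), (coeff (c F i) (g i) / coeff (T' i) (g i)) := by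
    intro F hF
    set bF : Fin m → (Fin 2 →₀ ℕ) := fun j => if j ∈ F then a j else T j with hbF
    have hb : ∀ j, bF j = a j ∨ bF j = T j := by
      intro j; by_cases hj : j ∈ F
      · left; simp only [hbF, if_pos hj]
      · right; simp only [hbF, if_neg hj]
    obtain ⟨F', hF', hFF'⟩ : ∃ F' ∈ P, F' ≠ F := by
      by_contra hno
      push Not at hno
      have : P ⊆ {F} := fun G hG => Finset.mem_singleton.2 (hno G hG)
      have := Finset.card_le_card this
      rw [Finset.card_singleton] at this
      omega
    obtain ⟨j₁, hj₁⟩ := hPne F' hF'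
    have hj₁F : j₁ ∉ F := fun h => Finset.disjoint_left.1 (hPdisj F' hF' F hF hFF') hj₁ h
    have hj₁J : a j₁ ≠ T j₁ := ne_T_of_mem_filter T (hFJ F' hF' hj₁)
    have hne : bF ≠ a := by
      intro h
      have := congrFun h j₁
      simp only [hbF, if_neg hj₁F] at this
      exact hj₁J this.symm
    obtain ⟨cF, hcF, hsum, hprod⟩ := promote_word l f g T hT hTmax hinjf hinjg e hzero ha hea hb hne
    have hcF_eq : cF = c F := hinjg _ _ hcF (hc F hF) (by rw [hsum, hcsum F hF])
    rw [hcF_eq] at hprod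
    have hratio := promote_ratio l f g T T' hT hT' hinjf hinjg e hzero htop hTe hprod
    have hfilt_b : Finset.univ.filter (fun i => bF i ≠ T i) = F := by
      ext j
      simp only [Finset.mem_filter, Finset.mem_univ, true_and, hbF]
      constructor
      · intro h
        by_contra hj
        rw [if_neg hj] at h
        exact h rfl
      · intro hj
        rw [if_pos hj]
        exact ne_T_of_mem_filter T (hFJ F hF hj)
    rw [hfilt_b] at hratio
    rw [← hratio]
    refine Finset.prod_congr rfl fun j hj => ?_
    simp only [hbF, if_pos hj]
  -- Step 2: glue the words `c F` along their (disjoint) demotion sets.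
  have huniq : ∀ i, (∃ F ∈ P, c F i ≠ T' i) → ∃! F, F ∈ P ∧ c F i ≠ T' i := by
    rintro i ⟨F, hF, hi⟩
    refine ⟨F, ⟨hF, hi⟩, fun F' ⟨hF', hi'⟩ => ?_⟩
    by_contra hne
    have hd := hcdisj F' hF' F hF hne
    exact Finset.disjoint_left.1 hd (Finset.mem_filter.2 ⟨Finset.mem_univ _, hi'⟩) (Finset.mem_filter.2 ⟨Finset.mem_univ _, hi⟩)
  set b' : Fin m → (Fin 2 →₀ ℕ) := fun i =>
    if h : ∃ F ∈ P, c F i ≠ T' i then c (Finset.choose (fun F => c F i ≠ T' i) P (huniq i h)) i else T' i with hb'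
  have hb'_on : ∀ F ∈ P, ∀ i, c F i ≠ T' i → b' i = c F i := by
    intro F hF i hi
    have h : ∃ F' ∈ P, c F' i ≠ T' i := ⟨F, hF, hi⟩
    have hspec := Finset.choose_spec (fun F' => c F' i ≠ T' i) P (huniq i h)
    have hch : Finset.choose (fun F' => c F' i ≠ T' i) P (huniq i h) = F := by
      by_contra hne
      have hd := hcdisj _ hspec.1 F hF hne
      exact Finset.disjoint_left.1 hd (Finset.mem_filter.2 ⟨Finset.mem_univ _, hspec.2⟩) (Finset.mem_filter.2 ⟨Finset.mem_univ _, hi⟩)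
    simp only [hb', dif_pos h]
    rw [hch]
  have hb'_off : ∀ i, (¬ ∃ F ∈ P, c F i ≠ T' i) → b' i = T' i := by
    intro i h
    simp only [hb', dif_neg h]
  have hb'mem : ∀ i, b' i ∈ (g i).support := by
    intro i
    by_cases h : ∃ F ∈ P, c F i ≠ T' i
    · obtain ⟨F, hF, hi⟩ := h
      rw [hb'_on F hF i hi]; exact hc F hF i
    · rw [hb'_off i h]; exact hT' i
  -- demotion set of `b'` = union of the demotion sets of the `c F`
  have hfilt' : Finset.univ.filter (fun i => b' i ≠ T' i) =
      P.biUnion fun F => Finset.univ.filter fun i => c F i ≠ T' i := by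
    ext i
    simp only [Finset.mem_filter, Finset.mem_univ, true_and, Finset.mem_biUnion]
    constructor
    · intro h
      by_contra hno
      push Not at hno
      exact h (hb'_off i fun ⟨F, hF, hi⟩ => hi (hno F hF))
    · rintro ⟨F, hF, hi⟩
      rw [hb'_on F hF i hi]
      exact hi
  have hdisjD : (P : Set (Finset (Fin m))).PairwiseDisjoint
      (fun F => Finset.univ.filter fun i => c F i ≠ T' i) := by
    intro F hF F' hF' hFF'
    exact hcdisj F hF F' hF' hFF'
  have hdisjP : (P : Set (Finset (Fin m))).PairwiseDisjoint id := by
    intro F hF F' hF' hFF'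
    exact hPdisj F hF F' hF' hFF'
  -- gap sum of each `c F` = gap sum of the corner = `Σ_{j∈F} (T j − a j)`
  have hgapF : ∀ F ∈ P, ∑ i ∈ Finset.univ.filter (fun i => c F i ≠ T' i), (emb (T' i) - emb (c F i)) =
      ∑ j ∈ F, (emb (T j) - emb (a j)) := by
    intro F hF
    rw [← sum_gap_eq_sum_filter T' (c F)]
    have h1 : emb (∑ i, c F i) = emb (∑ j, T' j) - ∑ i, (emb (T' i) - emb (c F i)) := emb_sum_eq T' (c F)
    have h2 : emb (∑ i, c F i) = emb (∑ j, T j) - ∑ j ∈ F, (emb (T j) - emb (a j)) := by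
      rw [hcsum F hF, emb_sum_corner T a F]
    rw [htop] at h2
    have := h1.symm.trans h2
    exact sub_right_injective this
  -- the sum of `b'` is `e`
  have hsum' : ∑ i, b' i = e := by
    apply emb_injective
    rw [emb_sum_eq T' b', sum_gap_eq_sum_filter T' b', hfilt', Finset.sum_biUnion hdisjD]
    have h1 : ∑ F ∈ P, ∑ i ∈ Finset.univ.filter (fun i => c F i ≠ T' i), (emb (T' i) - emb (b' i)) =
        ∑ F ∈ P, ∑ j ∈ F, (emb (T j) - emb (a j)) := by
      refine Finset.sum_congr rfl fun F hF => ?_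
      rw [← hgapF F hF]
      refine Finset.sum_congr rfl fun i hi => ?_
      rw [Finset.mem_filter] at hi
      rw [hb'_on F hF i hi.2]
    have hsumU : ∑ F ∈ P, ∑ j ∈ F, (emb (T j) - emb (a j)) =
        ∑ j ∈ Finset.univ.filter (fun i => a i ≠ T i), (emb (T j) - emb (a j)) := by
      rw [← hPU, Finset.sum_biUnion hdisjP]
      rfl
    rw [h1, hsumU, ← sum_gap_eq_sum_filter T a, ← htop, ← emb_sum_eq T a, hea]
  -- Step 3: the coefficient of `b'` is minus that of `a`
  have htc := topCoeff_add_eq_zero l f g T T' hT hT' hinjf hinjg e hzero htop hTe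
  have hB : ∏ j, coeff (T' j) (g j) = -∏ j, coeff (T j) (f j) := eq_neg_of_add_eq_zero_right htc
  have hratio_all : ∏ i ∈ Finset.univ.filter (fun i => b' i ≠ T' i), (coeff (b' i) (g i) / coeff (T' i) (g i)) =
      ∏ j ∈ Finset.univ.filter (fun i => a i ≠ T i), (coeff (a j) (f j) / coeff (T j) (f j)) := by
    rw [hfilt', Finset.prod_biUnion hdisjD, ← hPU, Finset.prod_biUnion hdisjP]
    refine Finset.prod_congr rfl fun F hF => ?_
    rw [show (id F : Finset (Fin m)) = F from rfl, hblock F hF]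
    refine Finset.prod_congr rfl fun i hi => ?_
    rw [Finset.mem_filter] at hi
    rw [hb'_on F hF i hi.2]
  have hcoef : ∏ i, coeff (b' i) (g i) = -∏ j, coeff (a j) (f j) := by
    rw [prod_coeff_ratio g T' hT' b', prod_coeff_ratio f T hT a, hratio_all, hB, neg_mul]
  exact not_word_of_vertex f g hinjf hinjg e he ha hea hb'mem hsum' hcoef

/-- **Complementary corners collide.**  For `∅ ≠ F ⊊ J` (`J` the demotion set of the uncancelled vertex word `a`), if `c₁`, `c₂` are
words of `g` summing to the corners `a^F` (promote `a` outside `F`) and `a^{J∖F}` (promote `a` on `F`), then `c₁` and `c₂` demote a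
common coordinate of `g`. [ours] -/
theorem corner_words_collide (l : (Fin 2 → ℝ) →L[ℝ] ℝ) (f g : Fin m → MvPolynomial (Fin 2) ℂ)
    (T T' : Fin m → (Fin 2 →₀ ℕ))
    (hT : ∀ j, T j ∈ (f j).support) (hTmax : ∀ j, ∀ x ∈ (f j).support, lexKey l x ≤ lexKey l (T j))
    (hT' : ∀ j, T' j ∈ (g j).support)
    (hinjf : ∀ a b : Fin m → (Fin 2 →₀ ℕ), (∀ j, a j ∈ (f j).support) → (∀ j, b j ∈ (f j).support) →
      ∑ j, a j = ∑ j, b j → a = b)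
    (hinjg : ∀ a b : Fin m → (Fin 2 →₀ ℕ), (∀ j, a j ∈ (g j).support) → (∀ j, b j ∈ (g j).support) →
      ∑ j, a j = ∑ j, b j → a = b)
    (e : Fin 2 →₀ ℕ)
    (hzero : ∀ x : Fin 2 →₀ ℕ, x ≠ e → l (emb e) ≤ l (emb x) → coeff x (∏ j, f j) + coeff x (∏ j, g j) = 0)
    (he : coeff e (∏ j, f j) + coeff e (∏ j, g j) ≠ 0)
    (htop : ∑ j, T j = ∑ j, T' j) (hTe : lexKey l e < lexKey l (∑ j, T j))
    {a : Fin m → (Fin 2 →₀ ℕ)} (ha : ∀ j, a j ∈ (f j).support) (hea : ∑ j, a j = e)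
    (F : Finset (Fin m)) (hF : F ⊆ Finset.univ.filter fun i => a i ≠ T i) (hFne : F.Nonempty)
    (hFne' : ((Finset.univ.filter fun i => a i ≠ T i) \ F).Nonempty)
    {c₁ c₂ : Fin m → (Fin 2 →₀ ℕ)} (hc₁ : ∀ i, c₁ i ∈ (g i).support) (hc₂ : ∀ i, c₂ i ∈ (g i).support)
    (hc₁sum : ∑ i, c₁ i = ∑ j, (fun j => if j ∈ F then a j else T j) j)
    (hc₂sum : ∑ i, c₂ i = ∑ j, (fun j => if j ∈ (Finset.univ.filter fun i => a i ≠ T i) \ F then a j else T j) j) :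
    ∃ i, c₁ i ≠ T' i ∧ c₂ i ≠ T' i := by
  by_contra hno
  push Not at hno
  set J : Finset (Fin m) := Finset.univ.filter fun i => a i ≠ T i with hJ
  have hFne2 : F ≠ J \ F := by
    intro h
    obtain ⟨j, hj⟩ := hFne
    have hj' : j ∈ J \ F := h ▸ hj
    exact (Finset.mem_sdiff.1 hj').2 hj
  refine no_disjoint_corner_words_of_vertex l f g T T' hT hTmax hT' hinjf hinjg e hzero he htop hTe ha hea
    {F, J \ F} ?_ ?_ ?_ ?_ (fun G => if G = F then c₁ else c₂) ?_ ?_ ?_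
  · intro G hG
    rcases Finset.mem_insert.1 hG with rfl | hG
    · exact hFne
    · rw [Finset.mem_singleton.1 hG]; exact hFne'
  · intro G hG G' hG' hGG'
    rcases Finset.mem_insert.1 hG with rfl | hG <;> rcases Finset.mem_insert.1 hG' with rfl | hG'
    · exact absurd rfl hGG'
    · rw [Finset.mem_singleton.1 hG']; exact Finset.disjoint_sdiff
    · rw [Finset.mem_singleton.1 hG]; exact Finset.sdiff_disjoint
    · exact absurd ((Finset.mem_singleton.1 hG).trans (Finset.mem_singleton.1 hG').symm) hGG'
  · rw [Finset.biUnion_insert, Finset.singleton_biUnion]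
    show F ∪ (J \ F) = J
    exact Finset.union_sdiff_of_subset hF
  · rw [Finset.card_pair hFne2]
  · intro G hG i
    by_cases h : G = F
    · simp only [h, if_true]; exact hc₁ i
    · simp only [h, if_false]; exact hc₂ i
  · intro G hG
    rcases Finset.mem_insert.1 hG with rfl | hG
    · simp only [if_true]; exact hc₁sum
    · have hG' : G = J \ F := Finset.mem_singleton.1 hG
      have hne : G ≠ F := hG' ▸ hFne2.symm
      simp only [if_neg hne]
      rw [hc₂sum, hG']
  · intro G hG G' hG' hGG'
    have key : ∀ G ∈ ({F, J \ F} : Finset (Finset (Fin m))), ∀ G' ∈ ({F, J \ F} : Finset (Finset (Fin m))), G ≠ G' →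
        G = F → Disjoint (Finset.univ.filter fun i => (if G = F then c₁ else c₂) i ≠ T' i)
          (Finset.univ.filter fun i => (if G' = F then c₁ else c₂) i ≠ T' i) := by
      intro G hG G' hG' hGG' hGF
      have hG'F : G' ≠ F := fun h => hGG' (hGF.trans h.symm)
      simp only [hGF, if_true, if_neg hG'F]
      rw [Finset.disjoint_left]
      intro i hi hi'
      rw [Finset.mem_filter] at hi hi'
      exact hi'.2 (hno i hi.2)
    by_cases hGF : G = F
    · exact key G hG G' hG' hGG' hGF
    · have hG'F : G' = F := by
        rcases Finset.mem_insert.1 hG with h | h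
        · exact absurd h hGF
        · rcases Finset.mem_insert.1 hG' with h' | h'
          · exact h'
          · exact absurd ((Finset.mem_singleton.1 h).trans (Finset.mem_singleton.1 h').symm) hGG'
      exact (key G' hG' G hG (Ne.symm hGG') hG'F).symm

/-- **The finest case: single-letter demotions collide.**  If the demotion set `J` of the uncancelled vertex word has `≥ 2` elements and
`c j` (`j ∈ J`) are words of `g` summing to the one-letter demotions `T[j ↦ a j]`, then two of them demote a common coordinate of `g`.
In particular the non-member frame of a cross-cancelling vertex of member depth `≥ 2` always has an additive coincidence among its light
gap multisets (it is never "generic" in the sense of `hgen` of `…FrameRungTwoGenericShallow.lean`). [ours] -/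
theorem single_demotions_collide (l : (Fin 2 → ℝ) →L[ℝ] ℝ) (f g : Fin m → MvPolynomial (Fin 2) ℂ)
    (T T' : Fin m → (Fin 2 →₀ ℕ))
    (hT : ∀ j, T j ∈ (f j).support) (hTmax : ∀ j, ∀ x ∈ (f j).support, lexKey l x ≤ lexKey l (T j))
    (hT' : ∀ j, T' j ∈ (g j).support)
    (hinjf : ∀ a b : Fin m → (Fin 2 →₀ ℕ), (∀ j, a j ∈ (f j).support) → (∀ j, b j ∈ (f j).support) →
      ∑ j, a j = ∑ j, b j → a = b)
    (hinjg : ∀ a b : Fin m → (Fin 2 →₀ ℕ), (∀ j, a j ∈ (g j).support) → (∀ j, b j ∈ (g j).support) →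
      ∑ j, a j = ∑ j, b j → a = b)
    (e : Fin 2 →₀ ℕ)
    (hzero : ∀ x : Fin 2 →₀ ℕ, x ≠ e → l (emb e) ≤ l (emb x) → coeff x (∏ j, f j) + coeff x (∏ j, g j) = 0)
    (he : coeff e (∏ j, f j) + coeff e (∏ j, g j) ≠ 0)
    (htop : ∑ j, T j = ∑ j, T' j) (hTe : lexKey l e < lexKey l (∑ j, T j))
    {a : Fin m → (Fin 2 →₀ ℕ)} (ha : ∀ j, a j ∈ (f j).support) (hea : ∑ j, a j = e)
    (hJ2 : 2 ≤ (Finset.univ.filter fun i => a i ≠ T i).card)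
    (c : Fin m → Fin m → (Fin 2 →₀ ℕ)) (hc : ∀ j, a j ≠ T j → ∀ i, c j i ∈ (g i).support)
    (hcsum : ∀ j, a j ≠ T j → ∑ i, c j i = ∑ i, Function.update T j (a j) i) :
    ∃ j j', a j ≠ T j ∧ a j' ≠ T j' ∧ j ≠ j' ∧ ∃ i, c j i ≠ T' i ∧ c j' i ≠ T' i := by
  by_contra hno
  push Not at hno
  set J : Finset (Fin m) := Finset.univ.filter fun i => a i ≠ T i with hJ
  have hmemJ : ∀ j, j ∈ J ↔ a j ≠ T j := fun j => by simp [hJ]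
  -- the partition of `J` into singletons, with the word `c j` on `{j}`
  set P : Finset (Finset (Fin m)) := J.image fun j => ({j} : Finset (Fin m)) with hP
  set c' : Finset (Fin m) → Fin m → (Fin 2 →₀ ℕ) := fun G => if h : G.Nonempty then c (G.min' h) else T' with hc'
  have hc'j : ∀ j, c' {j} = c j := by
    intro j
    have h : ({j} : Finset (Fin m)).Nonempty := Finset.singleton_nonempty j
    simp only [hc', dif_pos h, Finset.min'_singleton]
  have hmemP : ∀ G, G ∈ P ↔ ∃ j, a j ≠ T j ∧ G = {j} := by
    intro G
    simp only [hP, Finset.mem_image, hmemJ]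
    exact ⟨fun ⟨j, hj, hG⟩ => ⟨j, hj, hG.symm⟩, fun ⟨j, hj, hG⟩ => ⟨j, hj, hG.symm⟩⟩
  refine no_disjoint_corner_words_of_vertex l f g T T' hT hTmax hT' hinjf hinjg e hzero he htop hTe ha hea P ?_ ?_ ?_ ?_ c' ?_ ?_ ?_
  · intro G hG
    obtain ⟨j, _, rfl⟩ := (hmemP G).1 hG
    exact Finset.singleton_nonempty j
  · intro G hG G' hG' hGG'
    obtain ⟨j, _, rfl⟩ := (hmemP G).1 hG
    obtain ⟨j', _, rfl⟩ := (hmemP G').1 hG'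
    rw [Finset.disjoint_singleton]
    exact fun h => hGG' (by rw [h])
  · ext i
    simp only [Finset.mem_biUnion, id, hmemP]
    constructor
    · rintro ⟨G, ⟨j, hj, rfl⟩, hi⟩
      rw [Finset.mem_singleton] at hi
      rw [hi]; exact (hmemJ j).2 hj
    · intro hi
      exact ⟨{i}, ⟨i, (hmemJ i).1 hi, rfl⟩, Finset.mem_singleton_self i⟩
  · rw [hP, Finset.card_image_of_injective J (Finset.singleton_injective)]
    exact hJ2
  · intro G hG i
    obtain ⟨j, hj, rfl⟩ := (hmemP G).1 hG
    rw [hc'j]; exact hc j hj i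
  · intro G hG
    obtain ⟨j, hj, rfl⟩ := (hmemP G).1 hG
    rw [hc'j, hcsum j hj]
    refine Finset.sum_congr rfl fun i _ => ?_
    by_cases hij : i = j
    · subst hij; simp
    · rw [Function.update_of_ne hij]
      simp [hij]
  · intro G hG G' hG' hGG'
    obtain ⟨j, hj, rfl⟩ := (hmemP G).1 hG
    obtain ⟨j', hj', rfl⟩ := (hmemP G').1 hG'
    have hjj' : j ≠ j' := fun h => hGG' (by rw [h])
    rw [hc'j, hc'j, Finset.disjoint_left]
    intro i hi hi'
    rw [Finset.mem_filter] at hi hi'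
    exact hi'.2 (hno j j' hj hj' hjj' i hi.2)

end CornerWords

end

end Summit.ValiantsHypothesis.ValiantsHypothesis.Theorems.NewtonFramesTwoProducts.FrameRungTwoTrinomial
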